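import Summits.ResolutionOfSingularities.ResolutionOfSingularities.Theorems.FrobeniusClosingSteerWords10SigmaResidualSlate
import Summits.ResolutionOfSingularities.ResolutionOfSingularities.Theorems.FrobeniusClosingSteerLowOrderAbsorbing
import Summits.ResolutionOfSingularities.ResolutionOfSingularities.Theorems.FrobeniusClosingSteerRunHygieneTwo

/-!
# Crux `Steer` (stmt-ResolutionOfSingularities-16345), line `switching-dichotomy` — WORDS 11: §σ2.18 THE HIGH HALF SPLIT (point tails / alternation / wander) and §σ2.20 NORMALISED START of the p = 2 σ_top-STEERED COMPOSITION (res-L0-w41-strat-2; plan-1 RULINGS 7/13c) (HOIST of the registered skeleton r38 cc5f2c8f0939be83, l.1120–1465, inside `section SteeredTwo`)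

Holder res-L0-w41-lead-1 g5 on res-L0-w41-plan-1 RULING 47 (E1) / 104b; see `…Words01Core` for the hoist protocol (bodies byte for byte;
`[cite: …]` / `[folklore]` tags on CLOSED `def … : Prop` words are written «(ref. …)» / «(folklore)» — GATE NOTE of `…Words02Stubs`;
cite keys inside `[cite:]` tags normalised to `references.bib` keys where needed, as in `…Words03Phases`).
Nothing here is a statement of the manuscript [claim: Hironaka2017, status: under-review]. OURS (candidates / vocabulary; AI review is
weaker than expert review).
-/

open Summit.ResolutionOfSingularities.ResolutionOfSingularities.Theses.FrobeniusClosing (IsolatedForcedTermination)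
open Literature.AlgebraicGeometry.Resolution (IsAbhyankarPlace FGOver exists_ringKrullDim_eq_and_trdeg_eq
  trdeg_eq_trdeg_of_isFractionRing locAtCentre IsQuadraticTransformAlong SubringDominates IsRsopPart
  LocalUniformization3 RelLocalUniformization CossartPiltant2019General)
open Summit.ResolutionOfSingularities.ResolutionOfSingularities.Theorems.SteerRankThinness
  (HasProperCoarsening concl_of_hasProperCoarsening rankOne_of_not_hasProperCoarsening)
open Summit.ResolutionOfSingularities.ResolutionOfSingularities.Theorems.PfaffLine

set_option linter.dupNamespace false

namespace Summit.ResolutionOfSingularities.ResolutionOfSingularities.Theorems.SwitchingDichotomy.Words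

section SteeredTwo

open IsLocalRing
open Literature.AlgebraicGeometry.Resolution (IsLocalBlowupAlong IsQuadraticTransform IsExcellentRing)

variable {K : Type} [Field K]


/-! ### §σ2.18 (res-L0-w41-strat-2 g0, 2026-08-27T07:5xZ) — THE HIGH HALF SPLIT: point tails (CLOSED modulo the B13 slate + run
hygiene) ∧ HIGH WANDER (frontier). Typed sub-cut of `HighOrderTailConclTwo` with kernel-checked glue; candidate r25 shape for the holder:
`stub_highOrderTailConclTwo := highOrderTailConclTwo_of_split (pointTailHighConclTwo_of_hygiene stub_runHygieneTwo) stub_highWanderConclTwo`.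
OURS (candidates; hand proofs behind the sorried B-lemmas; AI review weaker than expert review). -/

/-- **RUN HYGIENE at p = 2** (DISCHARGEABLE bookkeeping, S–M; every clause is a routine consequence of `CoreDatum` along a steered run):
`O ≠ K` (the centre has dimension > 2); every member is the localisation at the centre of a subring of `O` (`R 0` by `hR0`, `R (i+1)` by
`IsLocalBlowupAlong`); every member has Krull dimension 4 (`ZeroDim` + dimension formula, cf. `dims_of_separating_affineModel4`); residue
constants are squares (`PerfectField k` + `ZeroDim`); the generator `s j` is not a fraction of the member (`CoreDatum`'s non-`p`-th-power
row + normality, transported along `s j = x s (j+1) + g`); and `K² ⊆ Frac (R j)` (`K = Frac A₀[t]`, `t² ∈ A₀ ≤ R 0 ≤ R j`).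
OURS. (folklore) -/
def RunHygieneTwo : Prop :=
  ∀ p : ℕ, p = 2 →
    ∀ (k K : Type) [Field k] [CharP k p] [PerfectField k] [Field K] [Algebra k K]
    (O : ValuationSubring K) (A₀ : Subalgebra k K) (h₀ : A₀.toSubring ≤ O.toSubring) (t : K),
    CoreDatum p 4 k K O A₀ h₀ t → ¬ HasProperCoarsening O →
    ∀ (R : ℕ → Subring K) (P : (i : ℕ) → Ideal (R i)) (s : ℕ → K),
      R 0 = locAtCentre A₀.toSubring O → IsSteeredRun O R P t p s →
      O ≠ ⊤ ∧ (∀ j, ∃ B : Subring K, B ≤ O.toSubring ∧ R j = locAtCentre B O) ∧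
      (∀ j, ringKrullDim (R j) = 4) ∧
      (∀ j, ∀ (_ : IsLocalRing (R j)) (a : R j), ∃ b : R j, a - b ^ 2 ∈ IsLocalRing.maximalIdeal (R j)) ∧
      (∀ j, ∀ y z : R j, (z : K) ≠ 0 → s j * z ≠ y) ∧
      (∀ j, ∀ z : K, z ≠ 0 → ∃ a b : R j, (a : K) ≠ 0 ∧ (b : K) ≠ 0 ∧ z ^ 2 * (b : K) = a)

/-- **PT₁ ∩ HIGH · PointTailHighConclTwo** (CLOSED modulo B1, B4, B13a-1, B13a-2, B13b and `RunHygieneTwo` — see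
`pointTailHighConclTwo_of_hygiene`): an eventually-point, eventually-high-order steered run (p = 2, n = 4, rank one) yields `Concl` — in
fact it cannot exist (`pointTailHigh_discrete_two` makes `O` discrete, excluded by `CoreDatum`). OURS. (ref. HeinzerEtAl2015, Discussion 4.2) -/
def PointTailHighConclTwo : Prop :=
  ∀ p : ℕ, p = 2 →
    ∀ (k K : Type) [Field k] [CharP k p] [PerfectField k] [Field K] [Algebra k K]
    (O : ValuationSubring K) (A₀ : Subalgebra k K) (h₀ : A₀.toSubring ≤ O.toSubring) (t : K),
    CoreDatum p 4 k K O A₀ h₀ t → ¬ HasProperCoarsening O →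
    ∀ (R : ℕ → Subring K) (P : (i : ℕ) → Ideal (R i)) (s : ℕ → K),
      R 0 = locAtCentre A₀.toSubring O → IsSteeredRun O R P t p s →
      (∃ i₀ : ℕ, ∀ i, i₀ ≤ i → IsPointStep R P i) →
      (∃ i₀ : ℕ, ∀ i, i₀ ≤ i → IsHighOrderAt R s p i) → Concl O A₀ t

/-- **HIGH WANDER · HighWanderConclTwo** (FRONTIER — what is left of the HIGH half): p = 2, n = 4, rank one, no dominant tail,
eventually high order, and INFINITELY MANY positive-dimensional steps ⇒ `Concl`. Inhabited as typed by NON-REDUCED radicands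
(res-L0-w41-tri-3 U7 `t² = (w² + y³)²(1 + x)`: eternal legal `(P D)^ω`, `Concl` true by the regular model at hand), so the statement is
about `Concl`, not about non-existence; for SQUARE-FREE radicands the known continuation is the deep class (strat-2 memo §6, K4.1f).
`concl_regenerate` shows the reduction move `s ↦ s·b/a` is free on the conclusion side. Why it might fail: a square-free deep-class
member steering σ_top through infinitely many surface/curve steps with no regular model found by the σ_top frames.
OURS. (ref. CossartJannsenSaito2009, Thm. 5.25) -/
def HighWanderConclTwo : Prop :=
  ∀ p : ℕ, p = 2 →
    ∀ (k K : Type) [Field k] [CharP k p] [PerfectField k] [Field K] [Algebra k K]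
    (O : ValuationSubring K) (A₀ : Subalgebra k K) (h₀ : A₀.toSubring ≤ O.toSubring) (t : K),
    CoreDatum p 4 k K O A₀ h₀ t → ¬ HasProperCoarsening O →
    ∀ (R : ℕ → Subring K) (P : (i : ℕ) → Ideal (R i)) (s : ℕ → K),
      R 0 = locAtCentre A₀.toSubring O → IsSteeredRun O R P t p s →
      (¬ ∃ i₀ c : ℕ, 1 ≤ c ∧ IsDominantTail R P i₀ c) →
      (∀ i₀ : ℕ, ∃ i, i₀ ≤ i ∧ ¬ IsPointStep R P i) →
      (∃ i₀ : ℕ, ∀ i, i₀ ≤ i → IsHighOrderAt R s p i) → Concl O A₀ t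

/-- The HIGH half is point tails + wander (excluded middle on «eventually point steps only»). Pure logic. OURS. [folklore] -/
theorem highOrderTailConclTwo_of_split (hP : PointTailHighConclTwo) (hW : HighWanderConclTwo) :
    HighOrderTailConclTwo := by
  intro p hp k K _ _ _ _ _ O A₀ h₀ t hcore hrk R P s hR0 hrun hnd hhigh
  by_cases h : ∃ i₀ : ℕ, ∀ i, i₀ ≤ i → IsPointStep R P i
  · exact hP p hp k K O A₀ h₀ t hcore hrk R P s hR0 hrun h hhigh
  · refine hW p hp k K O A₀ h₀ t hcore hrk R P s hR0 hrun hnd (fun i₀ => ?_) hhigh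
    by_contra hc
    exact h ⟨i₀, fun i hi => by_contra fun hni => hc ⟨i, hi, hni⟩⟩

/-- **PT₁ ∩ HIGH is CLOSED modulo the B13 slate and run hygiene**: the no-switch theorem makes `O` discrete, which `CoreDatum` forbids.
Kernel-checked over the (sorried) stubs B1 `divisorTrigger_two`, B4 `noHeightOneCarrier_two`, B13a-1 `switch_plane_two`, B13a-2
`noEquimultiplePlane_pointStep_two`, B13b `discrete_of_persistentExcParam` and M `steeredMembersRegular_holds` (p501181). OURS. [folklore] -/
theorem pointTailHighConclTwo_of_hygiene (hyg : RunHygieneTwo) (hB4 : NoHeightOneCarrierTwo)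
    (hD1 : HighPointStepDecompositionTwo) (hD2 : SwitchPlaneOfDecompositionTwo) (hB13a2 : NoEquimultiplePlanePointStepTwo) :
    PointTailHighConclTwo := by
  intro p hp k K _i1 _i2 _i3 _i4 _i5 O A₀ h₀ t core hrk R P s hR0 hrun hpt hhigh
  subst hp
  haveI : CharP K 2 := charP_of_injective_algebraMap (algebraMap k K).injective 2
  obtain ⟨i₁, hpt⟩ := hpt
  obtain ⟨i₂, hhigh⟩ := hhigh
  obtain ⟨hO', hR, hdim, hperf, hirr, hK⟩ := hyg 2 rfl k K O A₀ h₀ t core hrk R P s hR0 hrun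
  have hreg : ∀ i, IsRegularLocalRing (R i) := fun i =>
    steeredMembersRegular_holds 2 Nat.prime_two 4 le_rfl k K O A₀ h₀ t core R P s i hR0
      ⟨hrun.1, fun j _ => by obtain ⟨_, hs, -⟩ := hrun.2 j; exact hs, fun j _ => hrun.2 j⟩
  have hD : Discrete O :=
    pointTailHigh_discrete_two hB4 hD1 hD2 hB13a2 O R P t s hrun hrk hO' hR hreg hdim hperf hirr (max i₁ i₂)
      (fun i hi => hpt i (le_trans (le_max_left _ _) hi)) (fun i hi => hhigh i (le_trans (le_max_right _ _) hi))
      (hK (max i₁ i₂))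
  obtain ⟨-, -, -, -, -, -, -, -, -, hnD, -⟩ := core
  exact absurd hD hnD

/-- **`RunHygieneTwo` holds** (adoption leaf over res-D-pv-028's LANDED p512522 `RunHygiene.runHygieneTwo_of_steeredRun`; pv-028's text
verbatim). OURS. [folklore] -/
theorem runHygieneTwo_holds : RunHygieneTwo := by
  intro p hp k K _i1 _i2 _i3 _i4 _i5 O A₀ h₀ t core _ R P s hR0 hrun
  subst hp
  obtain ⟨hfg, htp, hfr, hreg, -, h0, hdim, -, -, -, -, hc, htr, -⟩ := core
  exact _root_.Summit.ResolutionOfSingularities.ResolutionOfSingularities.Theorems.SwitchingDichotomy.RunHygiene.runHygieneTwo_of_steeredRun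
    O A₀ h₀ t hfg htp hfr hreg h0 hdim hc htr R P s hR0 (fun i => (hrun.2 i).2.2.2.1) (fun i => (hrun.2 i).2.2.2.2) hrun.1

/-- **tri-2 · low order is absorbing, one step** (§σ2.17) — PROVED: adoption leaf over
`Theorems.SwitchingDichotomy.LowOrderAbsorbing.not_highOrder_of_step_two` (res-L0-w41-stub-2 g4; derivation argument, uniform in
the height of the centre and in the residue field of the new point — no C-κ caveat). OURS. -/
theorem lowOrder_step_two [CharP K 2] (O : ValuationSubring K) (R : ℕ → Subring K) (P : (i : ℕ) → Ideal (R i))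
    (t : K) (s : ℕ → K) (hrun : IsSteeredRun O R P t 2 s) (i : ℕ)
    (hR : ∀ j, ∃ B : Subring K, B ≤ O.toSubring ∧ R j = locAtCentre B O)
    (hreg : IsRegularLocalRing (R i)) (hreg' : IsRegularLocalRing (R (i + 1)))
    (_hdim : ringKrullDim (R i) = 4) (_hdim' : ringKrullDim (R (i + 1)) = 4)
    (hperf : ∀ j, ∀ (_ : IsLocalRing (R j)) (a : R j), ∃ b : R j, a - b ^ 2 ∈ maximalIdeal (R j))
    (_hirr : ∀ j, ∀ y z : R j, (z : K) ≠ 0 → s j * z ≠ y)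
    (hlow : ¬ IsHighOrderAt R s 2 i) : ¬ IsHighOrderAt R s 2 (i + 1) := by
  rintro ⟨hloc', hs'mem, g', hg'⟩
  obtain ⟨hloc, hs, hcentre, hbl, x, g, hx, hg, hstep⟩ := hrun.2 i
  obtain ⟨⟨hxR, hxP⟩, hx0, hxmax⟩ := hx
  haveI := hreg
  haveI := hreg'
  have key : P i ≤ maximalIdeal (R i) ∧ IsRegularLocalRing (R i ⧸ P i) ∧
      ∃ g₀ : R i, (⟨s i ^ 2, hs⟩ : R i) - g₀ ^ 2 ∈ P i ^ 2 := by
    rcases hcentre with hperm | ⟨hPm, -, g₀, hg₀⟩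
    · obtain ⟨-, ⟨hprime, -⟩, hregq, g₀, hg₀⟩ := hperm
      exact ⟨IsLocalRing.le_maximalIdeal hprime.ne_top, hregq, g₀, hg₀⟩
    · refine ⟨hPm.le, ?_, g₀, hPm ▸ hg₀⟩
      rw [hPm]
      exact (inferInstance : IsRegularLocalRing (IsLocalRing.ResidueField (R i)))
  obtain ⟨hPle, hPreg, g₀, hg₀⟩ := key
  exact Summit.ResolutionOfSingularities.ResolutionOfSingularities.Theorems.SwitchingDichotomy.LowOrderAbsorbing.not_highOrder_of_step_two
    O (R i) (R (i + 1)) (hR i) (hperf i hloc) (P i) hPle hPreg ⟨s i ^ 2, hs⟩ g₀ hg₀ hbl x hxR hxP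
    hx0 hxmax g hg (s i) (s (i + 1)) rfl hstep hs'mem (fun h hh => hlow ⟨hloc, hs, h, hh⟩) g' hg'

/-- **The T-line's `step` binder, DISCHARGED** (`eternalSteeredRunTwo_of_slate_low''` & co.): from `CoreDatum` + the run, the hypotheses of
`lowOrder_step_two` are supplied by M (`steeredMembersRegular_holds`) and pv-028's run hygiene (`RunHygiene.runHygieneTwo_of_steeredRun`,
called on the core datum's components exactly as `runHygieneTwo_holds` does — no `¬ HasProperCoarsening` needed). OURS. -/
theorem lowOrderStep_holds : ∀ p : ℕ, p = 2 →
    ∀ (k K : Type) [Field k] [CharP k p] [PerfectField k] [Field K] [Algebra k K]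
    (O : ValuationSubring K) (A₀ : Subalgebra k K) (h₀ : A₀.toSubring ≤ O.toSubring) (t : K),
    CoreDatum p 4 k K O A₀ h₀ t →
    ∀ (R : ℕ → Subring K) (P : (i : ℕ) → Ideal (R i)) (s : ℕ → K),
      R 0 = locAtCentre A₀.toSubring O → IsSteeredRun O R P t p s →
      ∀ i, ¬ IsHighOrderAt R s p i → ¬ IsHighOrderAt R s p (i + 1) := by
  intro p hp k K _i1 _i2 _i3 _i4 _i5 O A₀ h₀ t core R P s hR0 hrun i
  subst hp
  haveI : CharP K 2 := charP_of_injective_algebraMap (algebraMap k K).injective 2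
  have hreg : ∀ i, IsRegularLocalRing (R i) := fun i =>
    steeredMembersRegular_holds 2 Nat.prime_two 4 le_rfl k K O A₀ h₀ t core R P s i hR0
      ⟨hrun.1, fun j _ => by obtain ⟨_, hs, -⟩ := hrun.2 j; exact hs, fun j _ => hrun.2 j⟩
  obtain ⟨hfg, htp, hfr, hreg0, -, h0, hdim, -, -, -, -, hc, htr, -⟩ := core
  obtain ⟨-, hR, hdim4, hperf, hirr, -⟩ :=
    _root_.Summit.ResolutionOfSingularities.ResolutionOfSingularities.Theorems.SwitchingDichotomy.RunHygiene.runHygieneTwo_of_steeredRun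
      O A₀ h₀ t hfg htp hfr hreg0 h0 hdim hc htr R P s hR0 (fun i => (hrun.2 i).2.2.2.1) (fun i => (hrun.2 i).2.2.2.2) hrun.1
  exact lowOrder_step_two O R P t s hrun i hR (hreg i) (hreg (i + 1)) (hdim4 i) (hdim4 (i + 1)) hperf hirr

/-- **PT₁ ∩ HIGH modulo the three remaining B-pieces** (hygiene and B13a-1′ discharged): `PointTailHighConclTwo` from B4, B13a-1″ and
B13a-2 — all leaves now except B4, so from B4 ALONE (`pointTailHighConclTwo_of_B4`). Pure logic. OURS. [folklore] -/
theorem pointTailHighConclTwo_of_B4 (hB4 : NoHeightOneCarrierTwo) : PointTailHighConclTwo :=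
  pointTailHighConclTwo_of_hygiene runHygieneTwo_holds hB4 highPointStepDecompositionTwo_holds
    switchPlaneOfDecompositionTwo_holds noEquimultiplePlanePointStepTwo_holds

/-- **PT₁ ∩ HIGH CLOSED ON THE RECORD** (all five inputs are leaves: RunHygiene pv-028, B4 096, B13a-1′ 076, B13a-1″ 062, B13a-2 072): an
eternally-point, eventually-high σ_top run at p = 2, n = 4, rank one forces a DISCRETE valuation — excluded by the core datum. OURS. [folklore] -/
theorem pointTailHighConclTwo_holds : PointTailHighConclTwo := pointTailHighConclTwo_of_B4 noHeightOneCarrierTwo_holds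

/-! ### §σ2.20 (res-L0-w41-plan-1 RULING 7 07:54:40Z, typed by res-L0-w41-strat-2 08:1xZ) — NORMALISED START.
U7 (res-L0-w41-tri-3: `t² = (w² + y³)²(1 + x)` runs `(P S⁺)^ω` legally, HIGH for ever, `Concl` true) showed that σ_top of record never divides
the generator by a SINGULAR square factor. Cure (plan-1): normalise ONCE at stage 0 inside the fixed ring `locAtCentre A₀ O` (N0 `Concl` is
generator-free — cf. `concl_regenerate` —, N1 ACC on the Jacobian ideal, N2 `CoreDatum` transport) and carry «no singular carrier» as a
propagated invariant (N4, N5). Here: the two instance-free defs, the dischargeable piece `NormalisedStartTwo`, the residual words with the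
ONE extra hypothesis `hN : NormalAt O (R 0) p t` (`…N`), their glue, and the kernels `eternalSteeredRunTwo_of_normalised(_lipman)` — the GIVEN
run is discarded and σ_top is re-run from the normalised datum (E/X/B₂ by name). Divisibility and primality in `NoSingularCarrier` live in
the subring `↥R`, never in `K` (tri-1 t1); `NormalAt` uses `O.valuation h < 1`, which is `h ∈ 𝔪_R` only under domination (t2); only the
weaker `NoSingularCarrier` is meant to propagate (t3). OURS (candidates; AI review weaker than expert review). -/

/-- **NormalAt** (OURS, plan-1 RULING 7 (N3) = idea-3 `RadicandReduced` in subring form): the radicand `t ^ p` has NO representation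
`g ^ p + h ^ p · u` over `R` with `h` of positive value — no square (p-th power) carrier at all at this stage. Instance-free. [folklore] -/
def NormalAt (O : ValuationSubring K) (R : Subring K) (p : ℕ) (t : K) : Prop :=
  ∀ g h u : K, g ∈ R → h ∈ R → u ∈ R → O.valuation h < 1 → t ^ p ≠ g ^ p + h ^ p * u

/-- **NoSingularCarrier** (OURS, plan-1 RULING 7 (N3)): every prime factor `q` (IN the subring `R`) of a carrier `h`
(`t ^ p = g ^ p + h ^ p · u` over `R`) has a REGULAR quotient `R ⧸ (q)` — regular and normal-crossings carriers are legal and transient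
(B1's divisor steps strip them), only singular prime carriers are banned. Instance-free; the propagated invariant of (N4). [folklore] -/
def NoSingularCarrier (_O : ValuationSubring K) (R : Subring K) (p : ℕ) (t : K) : Prop :=
  ∀ g h u : K, g ∈ R → ∀ hh : h ∈ R, u ∈ R → t ^ p = g ^ p + h ^ p * u →
    ∀ q : R, Prime q → q ∣ (⟨h, hh⟩ : R) → IsRegularLocalRing (R ⧸ Ideal.span {q})

/-- `NormalAt` trivially implies `NoSingularCarrier` at the same stage (no carrier of positive value at all; a carrier of value 1 is a
unit and has no prime factor). Needs domination of `R` by `O` to turn «non-unit of `R`» into «value < 1»; stated with that binder.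
Pure bookkeeping, PROVED. OURS. [folklore] -/
theorem noSingularCarrier_of_normalAt (O : ValuationSubring K) (R : Subring K) (p : ℕ) (t : K)
    (hdom : ∀ x : R, ¬ IsUnit x → O.valuation (x : K) < 1) (hN : NormalAt O R p t) :
    NoSingularCarrier O R p t := by
  intro g h u hg hh hu heq q hq hqh
  exfalso
  refine hN g h u hg hh hu (hdom ⟨h, hh⟩ fun hunit => ?_) heq
  exact hq.not_unit (isUnit_of_dvd_unit hqh hunit)

/-- **NormalisedStartTwo** (DISCHARGEABLE, M = N0 + N1 + N2; res-D-pv-012 / res-D-pv-007): from a core datum at `p = 2` EITHER `Concl`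
outright (the normalised torsor is regular at the centre) OR a normalised core datum `(A₁, t₁)` — same `K`, same `O`, `NormalAt` at
`locAtCentre A₁ O` — whose `Concl` implies the original one (`Concl` is generator-free: `concl_regenerate` / `concl_of_pow_mem`).
OURS. (folklore) -/
def NormalisedStartTwo : Prop :=
  ∀ p : ℕ, p = 2 →
    ∀ (k K : Type) [Field k] [CharP k p] [PerfectField k] [Field K] [Algebra k K]
    (O : ValuationSubring K) (A₀ : Subalgebra k K) (h₀ : A₀.toSubring ≤ O.toSubring) (t : K),
    CoreDatum p 4 k K O A₀ h₀ t →
      Concl O A₀ t ∨ ∃ (A₁ : Subalgebra k K) (h₁ : A₁.toSubring ≤ O.toSubring) (t₁ : K),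
        CoreDatum p 4 k K O A₁ h₁ t₁ ∧ NormalAt O (locAtCentre A₁.toSubring O) p t₁ ∧ (Concl O A₁ t₁ → Concl O A₀ t)

/-- **Tᴺ · EternalSteeredRunTwoN**: `EternalSteeredRunTwo` restricted to runs from a NORMALISED start (`hN` after `hR0`). OURS. (folklore) -/
def EternalSteeredRunTwoN : Prop :=
  ∀ p : ℕ, p = 2 →
    ∀ (k K : Type) [Field k] [CharP k p] [PerfectField k] [Field K] [Algebra k K]
    (O : ValuationSubring K) (A₀ : Subalgebra k K) (h₀ : A₀.toSubring ≤ O.toSubring) (t : K),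
    CoreDatum p 4 k K O A₀ h₀ t → ¬ HasProperCoarsening O →
    ∀ (R : ℕ → Subring K) (P : (i : ℕ) → Ideal (R i)) (s : ℕ → K),
      R 0 = locAtCentre A₀.toSubring O → NormalAt O (R 0) p t → IsSteeredRun O R P t p s → Concl O A₀ t

/-- **σ-RESIDUALᴺ · SteeredTailConclTwoN** (FRONTIER words of record after RULING 7: `SteeredTailConclTwo` + `hN`). OURS.
(ref. HeinzerEtAl2015, Discussion 4.2) -/
def SteeredTailConclTwoN : Prop :=
  ∀ p : ℕ, p = 2 →
    ∀ (k K : Type) [Field k] [CharP k p] [PerfectField k] [Field K] [Algebra k K]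
    (O : ValuationSubring K) (A₀ : Subalgebra k K) (h₀ : A₀.toSubring ≤ O.toSubring) (t : K),
    CoreDatum p 4 k K O A₀ h₀ t → ¬ HasProperCoarsening O →
    ∀ (R : ℕ → Subring K) (P : (i : ℕ) → Ideal (R i)) (s : ℕ → K),
      R 0 = locAtCentre A₀.toSubring O → NormalAt O (R 0) p t → IsSteeredRun O R P t p s →
      (¬ ∃ i₀ c : ℕ, 1 ≤ c ∧ IsDominantTail R P i₀ c) → Concl O A₀ t

/-- **HIGHᴺ · HighOrderTailConclTwoN** (`HighOrderTailConclTwo` + `hN`). OURS. (ref. CossartJannsenSaito2009, Thm. 5.25) -/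
def HighOrderTailConclTwoN : Prop :=
  ∀ p : ℕ, p = 2 →
    ∀ (k K : Type) [Field k] [CharP k p] [PerfectField k] [Field K] [Algebra k K]
    (O : ValuationSubring K) (A₀ : Subalgebra k K) (h₀ : A₀.toSubring ≤ O.toSubring) (t : K),
    CoreDatum p 4 k K O A₀ h₀ t → ¬ HasProperCoarsening O →
    ∀ (R : ℕ → Subring K) (P : (i : ℕ) → Ideal (R i)) (s : ℕ → K),
      R 0 = locAtCentre A₀.toSubring O → NormalAt O (R 0) p t → IsSteeredRun O R P t p s →
      (¬ ∃ i₀ c : ℕ, 1 ≤ c ∧ IsDominantTail R P i₀ c) →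
      (∃ i₀ : ℕ, ∀ i, i₀ ≤ i → IsHighOrderAt R s p i) → Concl O A₀ t

/-- **LOWᴺ · LowOrderTailConclTwoN** (`LowOrderTailConclTwo` + `hN`; idea-3 / tri-2). OURS. (ref. CutkoskyMourtada2019, Thm. 7.1) -/
def LowOrderTailConclTwoN : Prop :=
  ∀ p : ℕ, p = 2 →
    ∀ (k K : Type) [Field k] [CharP k p] [PerfectField k] [Field K] [Algebra k K]
    (O : ValuationSubring K) (A₀ : Subalgebra k K) (h₀ : A₀.toSubring ≤ O.toSubring) (t : K),
    CoreDatum p 4 k K O A₀ h₀ t → ¬ HasProperCoarsening O →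
    ∀ (R : ℕ → Subring K) (P : (i : ℕ) → Ideal (R i)) (s : ℕ → K),
      R 0 = locAtCentre A₀.toSubring O → NormalAt O (R 0) p t → IsSteeredRun O R P t p s →
      (¬ ∃ i₀ c : ℕ, 1 ≤ c ∧ IsDominantTail R P i₀ c) →
      (∀ i₀ : ℕ, ∃ i, i₀ ≤ i ∧ ¬ IsHighOrderAt R s p i) → Concl O A₀ t

/-- **HIGH WANDERᴺ · HighWanderConclTwoN** — THE HIGH FRONTIER NAME after RULING 7 (`HighWanderConclTwo` + `hN`): a normalised start,
no dominant tail, eventually HIGH, infinitely many positive-dimensional steps ⇒ `Concl`. U7/U7′ no longer inhabit the hypothesis; content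
= all-HIGH runs with infinitely many BIRTHS (strat-2 memo §6′ (W-f)). OURS. (ref. CossartJannsenSaito2009, Thm. 5.25) -/
def HighWanderConclTwoN : Prop :=
  ∀ p : ℕ, p = 2 →
    ∀ (k K : Type) [Field k] [CharP k p] [PerfectField k] [Field K] [Algebra k K]
    (O : ValuationSubring K) (A₀ : Subalgebra k K) (h₀ : A₀.toSubring ≤ O.toSubring) (t : K),
    CoreDatum p 4 k K O A₀ h₀ t → ¬ HasProperCoarsening O →
    ∀ (R : ℕ → Subring K) (P : (i : ℕ) → Ideal (R i)) (s : ℕ → K),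
      R 0 = locAtCentre A₀.toSubring O → NormalAt O (R 0) p t → IsSteeredRun O R P t p s →
      (¬ ∃ i₀ c : ℕ, 1 ≤ c ∧ IsDominantTail R P i₀ c) →
      (∀ i₀ : ℕ, ∃ i, i₀ ≤ i ∧ ¬ IsPointStep R P i) →
      (∃ i₀ : ℕ, ∀ i, i₀ ≤ i → IsHighOrderAt R s p i) → Concl O A₀ t

/-- The `…N` words are WEAKENINGS of the old ones (sanity; pure logic). OURS. [folklore] -/
theorem highWanderConclTwoN_of_plain (h : HighWanderConclTwo) : HighWanderConclTwoN :=
  fun p hp k K _ _ _ _ _ O A₀ h₀ t core hrk R P s hR0 _ hrun hnd hio hhigh =>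
    h p hp k K O A₀ h₀ t core hrk R P s hR0 hrun hnd hio hhigh

/-- Regime glue, normalised (excluded middle). Pure logic. OURS. [folklore] -/
theorem steeredTailConclTwoN_of_orders (hH : HighOrderTailConclTwoN) (hL : LowOrderTailConclTwoN) :
    SteeredTailConclTwoN := by
  intro p hp k K _ _ _ _ _ O A₀ h₀ t hcore hrk R P s hR0 hN hrun hnd
  by_cases h : ∃ i₀ : ℕ, ∀ i, i₀ ≤ i → IsHighOrderAt R s p i
  · exact hH p hp k K O A₀ h₀ t hcore hrk R P s hR0 hN hrun hnd h
  · refine hL p hp k K O A₀ h₀ t hcore hrk R P s hR0 hN hrun hnd fun i₀ => ?_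
    by_contra hc
    exact h ⟨i₀, fun i hi => by_contra fun hni => hc ⟨i, hi, hni⟩⟩

/-- HIGH split, normalised: point tails need NO `hN` (`PointTailHighConclTwo`, closed modulo the B13 slate), wander carries it.
Pure logic. OURS. [folklore] -/
theorem highOrderTailConclTwoN_of_split (hP : PointTailHighConclTwo) (hW : HighWanderConclTwoN) :
    HighOrderTailConclTwoN := by
  intro p hp k K _ _ _ _ _ O A₀ h₀ t hcore hrk R P s hR0 hN hrun hnd hhigh
  by_cases h : ∃ i₀ : ℕ, ∀ i, i₀ ≤ i → IsPointStep R P i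
  · exact hP p hp k K O A₀ h₀ t hcore hrk R P s hR0 hrun h hhigh
  · refine hW p hp k K O A₀ h₀ t hcore hrk R P s hR0 hN hrun hnd (fun i₀ => ?_) hhigh
    by_contra hc
    exact h ⟨i₀, fun i hi => by_contra fun hni => hc ⟨i, hi, hni⟩⟩

/-- **Tᴺ from its line** (GeoDict + codimension bound + K(1..3), e-free): copy of `eternalSteeredRunTwo_of` with `hN` threaded.
Pure logic. OURS. [folklore] -/
theorem eternalSteeredRunTwoN_of (hTail : SteeredTailConclTwoN) (hG : GeoDict) (hcb : TailCodimBound)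
    (hK1 : ∀ p : ℕ, p.Prime → NoEternalIsolatedRadicandChain p 1)
    (hK2 : ∀ p : ℕ, p.Prime → NoEternalIsolatedRadicandChain p 2)
    (hK3 : ∀ p : ℕ, p.Prime → NoEternalIsolatedRadicandChain p 3) : EternalSteeredRunTwoN := by
  intro p hp2 k K _i1 _i2 _i3 _i4 _i5 O A₀ h₀ t core hrank R P s hR0 hN hrun
  have hp : p.Prime := hp2 ▸ Nat.prime_two
  by_cases htail : ∃ i₀ c : ℕ, 1 ≤ c ∧ IsDominantTail R P i₀ c
  · obtain ⟨i₀, c, hc1, ht⟩ := htail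
    have hnc : ¬ NoEternalIsolatedRadicandChain p c := hG p hp 4 le_rfl k K O A₀ h₀ t core R P s i₀ c hR0 hrun ht
    have hc4 : c + 1 ≤ 4 := hcb p hp 4 le_rfl k K O A₀ h₀ t core R P s i₀ c hR0 hrun ht
    have hc3 : c ≤ 3 := by omega
    interval_cases c
    · exact (hnc (hK1 p hp)).elim
    · exact (hnc (hK2 p hp)).elim
    · exact (hnc (hK3 p hp)).elim
  · exact hTail p hp2 k K O A₀ h₀ t core hrank R P s hR0 hN hrun htail

/-- **THE NORMALISED KERNEL** (RULING 7): the GIVEN run is discarded; `NormalisedStartTwo` gives `Concl` or a normalised datum `(A₁, t₁)`,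
on which σ_top is re-run (E `steeredRunExists_holds`): exit ⇒ X `steeredExit_holds`; stall ⇒ impossible (B₂ `emptyStallTwo_holds`);
eternal ⇒ Tᴺ (with `hN` by the `R 0 = locAtCentre A₁ O` rewrite); finally `Concl O A₁ t₁ → Concl O A₀ t`. Kernel-checked. OURS. [folklore] -/
theorem eternalSteeredRunTwo_of_normalStart (hNS : NormalisedStartTwo) (hT : EternalSteeredRunTwoN) :
    EternalSteeredRunTwo := by
  intro p hp2 k K _i1 _i2 _i3 _i4 _i5 O A₀ h₀ t core hrank _R _P _s _hR0 _hrun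
  have hp : p.Prime := hp2 ▸ Nat.prime_two
  rcases hNS p hp2 k K O A₀ h₀ t core with hC | ⟨A₁, h₁, t₁, core₁, hN₁, himp⟩
  · exact hC
  · apply himp
    rcases steeredRunExists_holds p hp 4 le_rfl k K O A₁ h₁ t₁ core₁ with
      ⟨R₁, P₁, s₁, N, hR0₁, hrun₁, hexit | hstall⟩ | ⟨R₁, P₁, s₁, hR0₁, hrun₁⟩
    · exact steeredExit_holds p hp 4 le_rfl k K O A₁ h₁ t₁ core₁ R₁ P₁ s₁ N hR0₁ hrun₁ hexit
    · exact (emptyStallTwo_holds p hp2 4 le_rfl k K O A₁ h₁ t₁ core₁ R₁ P₁ s₁ N hR0₁ hrun₁ hstall).elim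
    · exact hT p hp2 k K O A₁ h₁ t₁ core₁ hrank R₁ P₁ s₁ hR0₁ (hR0₁ ▸ hN₁) hrun₁

/-- **`eternalSteeredRunTwo_of_normalised`** (RULING 7's e-free kernel): `NormalisedStartTwo → SteeredTailConclTwoN → GeoDict →
TailCodimBound → K(1) → K(2) → K(3) → EternalSteeredRunTwo`. Pure logic. OURS. [folklore] -/
theorem eternalSteeredRunTwo_of_normalised (hNS : NormalisedStartTwo) (hTail : SteeredTailConclTwoN) (hG : GeoDict)
    (hcb : TailCodimBound)
    (hK1 : ∀ p : ℕ, p.Prime → NoEternalIsolatedRadicandChain p 1)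
    (hK2 : ∀ p : ℕ, p.Prime → NoEternalIsolatedRadicandChain p 2)
    (hK3 : ∀ p : ℕ, p.Prime → NoEternalIsolatedRadicandChain p 3) : EternalSteeredRunTwo :=
  eternalSteeredRunTwo_of_normalStart hNS (eternalSteeredRunTwoN_of hTail hG hcb hK1 hK2 hK3)

/-- **`eternalSteeredRunTwo_of_normalised_debts`** (r24 form of RULING 7's debts kernel): `NormalisedStartTwo → SteeredTailConclTwoN →
Lipman1978 → CossartPiltant2019(branch) → EternalSteeredRunTwo`, G/S/K(1) by name from the tree. Pure logic. OURS. [folklore] -/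
theorem eternalSteeredRunTwo_of_normalised_debts (hNS : NormalisedStartTwo) (hTail : SteeredTailConclTwoN)
    (hL : Literature.AlgebraicGeometry.Resolution.Lipman1978NoEternalNormalBranch.{0})
    (hCP : Literature.AlgebraicGeometry.Resolution.CossartPiltant2019HironakaLUIsolatedBranch.{0}) : EternalSteeredRunTwo :=
  eternalSteeredRunTwo_of_normalStart hNS
    (eternalSteeredRunTwoN_of hTail geoDict_holds tailCodimBound_holds noEternalIsolatedRadicandChain_one_holds
      (noEternalIsolatedRadicandChain_two_of_lipman hL) (noEternalIsolatedRadicandChain_three_of_CP hCP))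

/-- **… through the regime pair + HIGH split (r24 form): T ⇐ NormalisedStart, PointTailHigh (B13 slate), HIGH WANDERᴺ, LOWᴺ + two named
facts.** Pure logic. OURS. [folklore] -/
theorem eternalSteeredRunTwo_of_normalised_split_debts (hNS : NormalisedStartTwo)
    (hP : PointTailHighConclTwo) (hW : HighWanderConclTwoN) (hLow : LowOrderTailConclTwoN)
    (hL : Literature.AlgebraicGeometry.Resolution.Lipman1978NoEternalNormalBranch.{0})
    (hCP : Literature.AlgebraicGeometry.Resolution.CossartPiltant2019HironakaLUIsolatedBranch.{0}) : EternalSteeredRunTwo :=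
  eternalSteeredRunTwo_of_normalised_debts hNS
    (steeredTailConclTwoN_of_orders (highOrderTailConclTwoN_of_split hP hW) hLow) hL hCP


end SteeredTwo

end Summit.ResolutionOfSingularities.ResolutionOfSingularities.Theorems.SwitchingDichotomy.Words
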